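import Literature.Analysis.Calculus.CoordinateJetsTD
import HarnessLib

/-!
# The Gilbarg–Trudinger 17.16 bootstrap, I: the hierarchy of differentiated equations

First layer of the a-priori bootstrap of Gilbarg–Trudinger (2001), Lemma 17.16 (uniform
`C^{2,α}` bounds for solutions of a smooth fully nonlinear uniformly elliptic equation
`G(y, θ, cjet₂ u(y)) = 0` give uniform bounds of all derivatives), see
`Literature/Analysis/PDE/EllipticSmoothBootstrap.lean` for the theorem.  Here we build the
hierarchy of differentiated equations with the coordinate jets of
`Literature/Analysis/Calculus/CoordinateJets.lean` and the total derivative `TD` of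
`Literature/Analysis/Calculus/CoordinateJetsTD.lean`:

* `iterTD bE n M G`: the `n`-fold total derivative of `G : E × P × CJet ι 2 → ℝ` along the basis
  directions `e_{M 0}, …, e_{M (n-1)}` (in this order; `M : Fin n → ι`), a function of
  `(y, θ, J) ∈ E × P × CJet ι (n + 2)`;
* its three invariants: it is `C^∞` where `G` is (`contDiffOn_iterTD`), it vanishes along the
  `(n+2)`-jets of a solution (`iterTD_comp_cjetOf_eq_zero`), and its derivative in the top jet
  slot is the derivative of `G` in its own top slot composed with
  `Ω ↦ (I₂ ↦ Ω (I₂ 0, I₂ 1, M))` (`fderiv_iterTD_single_last`: the principal symbol of every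
  differentiated equation is that of the original equation);
* two pieces of jet bookkeeping used to split a differentiated equation into its top-order part
  and a remainder depending on lower-order jets only: `truncTo2` (forget all slots above `2`) and
  `jetPad` (extend a jet by a zero top slot), with `ins_sub_single_last_eq`.

Everything here is pure calculus and fully proved; the elliptic estimates enter only in the later
files.

## References

* D. Gilbarg, N. S. Trudinger, *Elliptic Partial Differential Equations of Second Order*,
  Classics in Mathematics, Springer 2001, Lemma 17.16. [GilbargTrudinger2001]
-/

noncomputable section

open scoped ContDiff Topology
open Set Function Metric
open Literature.Analysis.Calculus

namespace Literature.Analysis.PDE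

variable {ι : Type*} [Fintype ι] {E : Type*} [NormedAddCommGroup E] [InnerProductSpace ℝ E]
variable {P : Type*} [NormedAddCommGroup P] [NormedSpace ℝ P]

/-! ### Jet bookkeeping: zero-padding and truncation to order two -/

section Jets

variable (ι)

/-- **Zero-padding** of an `m`-jet to an `(m+1)`-jet: `(jetPad J)_j = J_j` for `j ≤ m` and
`(jetPad J)_{m+1} = 0`. [folklore] -/
def jetPad (m : ℕ) : CJet ι m →L[ℝ] CJet ι (m + 1) :=
  ContinuousLinearMap.pi fun j : Fin (m + 2) =>
    if h : (j : ℕ) < m + 1 then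
      ContinuousLinearMap.proj (R := ℝ) (φ := fun i : Fin (m + 1) => (Fin (i : ℕ) → ι) → ℝ)
        ⟨j, h⟩
    else 0

/-- **Truncation to order two**: `(J₀, …, J_{n+2}) ↦ (J₀, J₁, J₂)`. [folklore] -/
def truncTo2 (n : ℕ) : CJet ι (n + 2) →L[ℝ] CJet ι 2 :=
  ContinuousLinearMap.pi fun j : Fin 3 =>
    ContinuousLinearMap.proj (R := ℝ) (φ := fun i : Fin (n + 3) => (Fin (i : ℕ) → ι) → ℝ)
      (Fin.castLE (by omega) j)

variable {ι}

omit [Fintype ι] in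
/-- The slots `j ≤ m` of the padded jet are those of the jet. [folklore] -/
theorem jetPad_apply_of_lt (m : ℕ) (J : CJet ι m) (j : Fin (m + 2)) (h : (j : ℕ) < m + 1)
    (I : Fin (j : ℕ) → ι) : jetPad ι m J j I = J ⟨j, h⟩ I := by
  simp only [jetPad, ContinuousLinearMap.pi_apply, dif_pos h]
  rfl

omit [Fintype ι] in
/-- The top slot of the padded jet vanishes. [folklore] -/
theorem jetPad_apply_of_not_lt (m : ℕ) (J : CJet ι m) (j : Fin (m + 2))
    (h : ¬ (j : ℕ) < m + 1) (I : Fin (j : ℕ) → ι) : jetPad ι m J j I = 0 := by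
  simp only [jetPad, ContinuousLinearMap.pi_apply, dif_neg h]
  rfl

omit [Fintype ι] in
/-- **The remainder vector of a differentiated equation depends on the lower slots only**: for an
`(m+1)`-jet `J`, removing from `ins i₀ J` its top slot leaves `ins i₀` of the zero-padded
truncation of `J`. [folklore] -/
theorem ins_sub_single_last_eq [DecidableEq ι] (m : ℕ) (i₀ : ι) (J : CJet ι (m + 1)) :
    CJet.ins ι m i₀ J -
        Pi.single (Fin.last m) (fun I : Fin m → ι => J (Fin.last (m + 1)) (Fin.snoc I i₀)) =
      CJet.ins ι m i₀ (jetPad ι m (CJet.trunc ι m J)) := by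
  funext j I
  simp only [Pi.sub_apply, CJet.ins_apply]
  by_cases hj : (j : ℕ) < m
  · have hne : j ≠ Fin.last m := fun h => by simp [h] at hj
    have hlt : ((Fin.succ j : Fin (m + 2)) : ℕ) < m + 1 := by simpa using hj
    rw [Pi.single_eq_of_ne hne, Pi.zero_apply, sub_zero, jetPad_apply_of_lt m _ _ hlt,
      CJet.trunc_apply]
    rfl
  · obtain rfl : j = Fin.last m :=
      Fin.ext (by have := j.isLt; simp only [Fin.val_last]; omega)
    have hnlt : ¬ ((Fin.succ (Fin.last m) : Fin (m + 2)) : ℕ) < m + 1 := by simp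
    rw [Pi.single_eq_same, jetPad_apply_of_not_lt m _ _ hnlt]
    exact sub_self _

omit [Fintype ι] in
/-- Components of the truncation to order two. [folklore] -/
theorem truncTo2_apply (n : ℕ) (J : CJet ι (n + 2)) (j : Fin 3) (I : Fin (j : ℕ) → ι) :
    truncTo2 ι n J j I = J (Fin.castLE (by omega) j) I := rfl

omit [Fintype ι] in
/-- In order two the truncation is the identity. [folklore] -/
theorem truncTo2_zero (J : CJet ι 2) : truncTo2 ι 0 J = J := rfl

omit [Fintype ι] in
/-- Truncating to order two factors through forgetting the top slot. [folklore] -/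
theorem truncTo2_succ (n : ℕ) (J : CJet ι (n + 3)) :
    truncTo2 ι (n + 1) J = truncTo2 ι n (CJet.trunc ι (n + 2) J) := rfl

/-- Truncating the `(n+2)`-jet of `u` to order two gives its `2`-jet, definitionally.
[folklore] -/
theorem truncTo2_cjetOf (bE : OrthonormalBasis ι ℝ E) (n : ℕ) (u : E → ℝ) (y : E) :
    truncTo2 ι n (cjetOf bE (n + 2) u y) = cjetOf bE 2 u y := rfl

end Jets

/-! ### The iterated total derivative and its invariants -/

/-- **Iterated total derivative** of `G : E × P × CJet ι 2 → ℝ` along the basis directions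
listed by `M : Fin n → ι` (the last entry of `M` is the outermost derivative):
`iterTD 0 _ G = G`, `iterTD (n+1) M G = TD e_{M n} (iterTD n (M 0, …, M (n-1)) G)`, a function of
`(y, θ, (n+2)-jet)`. Along the jets of a solution `u` of `G(y, θ, cjet₂ u(y)) = 0` it is the
`n`-th derivative `∂_{e_{M (n-1)}} ⋯ ∂_{e_{M 0}}` of the equation. [folklore] -/
def iterTD (bE : OrthonormalBasis ι ℝ E) :
    (n : ℕ) → (Fin n → ι) → (E × P × CJet ι 2 → ℝ) → (E × P × CJet ι (n + 2) → ℝ)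
  | 0, _, G => G
  | n + 1, M, G => TD bE (n + 2) (M (Fin.last n)) (iterTD bE n (Fin.init M) G)

/-- `iterTD 0 M G = G`. [folklore] -/
@[simp] theorem iterTD_zero (bE : OrthonormalBasis ι ℝ E) (M : Fin 0 → ι)
    (G : E × P × CJet ι 2 → ℝ) : iterTD bE 0 M G = G := rfl

/-- `iterTD (n+1) M G = TD e_{M n} (iterTD n (init M) G)`. [folklore] -/
theorem iterTD_succ (bE : OrthonormalBasis ι ℝ E) (n : ℕ) (M : Fin (n + 1) → ι)
    (G : E × P × CJet ι 2 → ℝ) :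
    iterTD bE (n + 1) M G = TD bE (n + 2) (M (Fin.last n)) (iterTD bE n (Fin.init M) G) := rfl

/-- `iterTD (n+1) (snoc M i) G = TD e_i (iterTD n M G)`. [folklore] -/
theorem iterTD_succ_snoc (bE : OrthonormalBasis ι ℝ E) (n : ℕ) (M : Fin n → ι) (i : ι)
    (G : E × P × CJet ι 2 → ℝ) :
    iterTD bE (n + 1) (Fin.snoc M i) G = TD bE (n + 2) i (iterTD bE n M G) := by
  rw [iterTD_succ, Fin.snoc_last, Fin.init_snoc]

/-- The set `{(y, θ, J) | y ∈ O}` in the form used by `contDiffOn_TD`. [folklore] -/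
theorem setOf_fst_mem_prod_univ {X Y Z : Type*} (O : Set X) :
    {x : X × Y × Z | (x.1, x.2.1) ∈ O ×ˢ (univ : Set Y)} = {x | x.1 ∈ O} := by
  ext x
  simp only [mem_setOf_eq, mem_prod, mem_univ, and_true]

/-- **Invariant (i): smoothness.** `iterTD n M G` is `C^∞` on `{y ∈ O}` if `G` is. [folklore] -/
theorem contDiffOn_iterTD (bE : OrthonormalBasis ι ℝ E) {G : E × P × CJet ι 2 → ℝ} {O : Set E}
    (hO : IsOpen O) (hG : ContDiffOn ℝ ∞ G {x | x.1 ∈ O}) :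
    ∀ (n : ℕ) (M : Fin n → ι), ContDiffOn ℝ ∞ (iterTD bE n M G) {x | x.1 ∈ O}
  | 0, _ => hG
  | n + 1, M => by
      have ih := contDiffOn_iterTD bE hO hG n (Fin.init M)
      rw [← setOf_fst_mem_prod_univ (Y := P) (Z := CJet ι (n + 2)) O] at ih
      have h := contDiffOn_TD bE (hO.prod isOpen_univ) ih (M (Fin.last n))
      rw [setOf_fst_mem_prod_univ] at h
      exact h

/-- Differentiability of `iterTD n M G` at the points over `O`. [folklore] -/
theorem differentiableAt_iterTD (bE : OrthonormalBasis ι ℝ E) {G : E × P × CJet ι 2 → ℝ}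
    {O : Set E} (hO : IsOpen O) (hG : ContDiffOn ℝ ∞ G {x | x.1 ∈ O}) (n : ℕ) (M : Fin n → ι)
    {y : E} (hy : y ∈ O) (θ : P) (J : CJet ι (n + 2)) :
    DifferentiableAt ℝ (iterTD bE n M G) (y, θ, J) := by
  have hopen : IsOpen {x : E × P × CJet ι (n + 2) | x.1 ∈ O} := hO.preimage continuous_fst
  exact ((contDiffOn_iterTD bE hO hG n M).differentiableOn (by simp)).differentiableAt
    (hopen.mem_nhds hy)

/-- **Invariant (ii): vanishing along the jets of a solution.** If `u ∈ C^∞(O)` solves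
`G(y, θ, cjet₂ u(y)) = 0` on a ball contained in `O`, then every differentiated equation holds
there: `iterTD n M G (y, θ, cjet_{n+2} u(y)) = 0`. [folklore] -/
theorem iterTD_comp_cjetOf_eq_zero (bE : OrthonormalBasis ι ℝ E) {G : E × P × CJet ι 2 → ℝ}
    {O : Set E} (hO : IsOpen O) (hG : ContDiffOn ℝ ∞ G {x | x.1 ∈ O}) {x₀ : E} {R : ℝ}
    (hRO : ball x₀ R ⊆ O) {θ : P} {u : E → ℝ} (hu : ContDiffOn ℝ ∞ u O)
    (h0 : ∀ y ∈ ball x₀ R, G (y, θ, cjetOf bE 2 u y) = 0) :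
    ∀ (n : ℕ) (M : Fin n → ι), ∀ y ∈ ball x₀ R, iterTD bE n M G (y, θ, cjetOf bE (n + 2) u y) = 0
  | 0, _ => h0
  | n + 1, M => by
      intro y hy
      rw [iterTD_succ]
      have hun : ContDiffOn ℝ (n + 2 + 1 : ℕ) u (ball x₀ R) := (contDiffOn_infty.1 hu _).mono hRO
      exact TD_comp_cjetOf_eq_zero bE isOpen_ball θ
        (fun z hz => differentiableAt_iterTD bE hO hG n (Fin.init M) (hRO hz) θ _) hun
        (iterTD_comp_cjetOf_eq_zero bE hO hG hRO hu h0 n (Fin.init M)) (M (Fin.last n)) y hy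

omit [Fintype ι] in
/-- Index bookkeeping for the base case: `(I 0, (I 1, ∅)) = I` on `Fin 2`. [folklore] -/
theorem cons_cons_fin_two (I : Fin 2 → ι) (M : Fin 0 → ι) :
    (Fin.cons (I 0) (Fin.cons (I 1) M : Fin 1 → ι) : Fin 2 → ι) = I := by
  funext t
  refine Fin.cases rfl (fun s => ?_) t
  refine Fin.cases rfl (fun r => r.elim0) s

/-- **Invariant (iii): the principal symbol is inherited.** Over `O`, the derivative of
`iterTD n M G` in the top jet slot, in direction `Ω`, is the derivative of `G` in its own top
slot in the direction `I₂ ↦ Ω (I₂ 0, I₂ 1, M 0, …, M (n-1))`. [folklore] -/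
theorem fderiv_iterTD_single_last (bE : OrthonormalBasis ι ℝ E) [DecidableEq ι]
    {G : E × P × CJet ι 2 → ℝ} {O : Set E} (hO : IsOpen O)
    (hG : ContDiffOn ℝ ∞ G {x | x.1 ∈ O}) :
    ∀ (n : ℕ) (M : Fin n → ι) {y : E} (_ : y ∈ O) (θ : P) (J : CJet ι (n + 2))
      (Ω : (Fin (n + 2) → ι) → ℝ),
      fderiv ℝ (iterTD bE n M G) (y, θ, J) ((0 : E), (0 : P), Pi.single (Fin.last (n + 2)) Ω) =
        fderiv ℝ G (y, θ, truncTo2 ι n J) ((0 : E), (0 : P), Pi.single (Fin.last 2)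
          (fun I₂ : Fin 2 → ι => Ω (Fin.cons (I₂ 0) (Fin.cons (I₂ 1) M))))
  | 0, M, y, _, θ, J, Ω => by
      simp only [iterTD_zero, truncTo2_zero, cons_cons_fin_two]
  | n + 1, M, y, hy, θ, J, Ω => by
      have ih := contDiffOn_iterTD bE hO hG n (Fin.init M)
      rw [← setOf_fst_mem_prod_univ (Y := P) (Z := CJet ι (n + 2)) O] at ih
      rw [iterTD_succ, fderiv_TD_single_last bE (hO.prod isOpen_univ) ih (M (Fin.last n))
        (y := y) (θ := θ) ⟨hy, mem_univ _⟩ J Ω,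
        fderiv_iterTD_single_last bE hO hG n (Fin.init M) hy θ _ _, ← truncTo2_succ]
      congr 3
      funext I₂
      simp only [← Fin.cons_snoc_eq_snoc_cons, Fin.snoc_init_self]

end Literature.Analysis.PDE
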